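import Summits.FinalStateConjecture.FinalStateConjecture.Theorems.InertialRecession.Negative.KinematicShadow

/-!
# Negative knowledge for the crux `InertialRecession` (item stmt-FinalStateConjecture-10166), II:
the kinematic shadow does not even give CESÀRO velocities

Refuter file (D-0016 negative lane, `--supports stmt-FinalStateConjecture-10166`); continues
`KinematicShadow.lean` (p73795). No Theses decl is asserted.

Background (crux card `Cruxes/InertialRecession/Ideas/cesaro-velocities-suffice.md`, prover analysis
on the item): the typed conclusion of the crux — a `C²` `FinalStateDecomposition` with constant motions,
sublinear excision tubes around STRAIGHT world-lines (`tendsto_excision_div`) and a flat chart on their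
complement — needs from the dynamics of hole `i` only a CESÀRO velocity, `ξᵢ(t)/t → Vᵢ`; instantaneous
velocity convergence is not required (the hole chart absorbs any modulation with `|Λ̇ᵢ| → 0`). This file
records that even this weaker datum is NOT supplied by the kinematics of the antecedent:

* `InertialRecessionWithoutFieldEquationsCesaro` — the kinematic shadow of the antecedent (one centre
  along one axis: `C^∞`, eventually inside the cone `κ² t`, speed `≤ κ²`, second and third derivatives
  `→ 0`) implies the CESÀRO SHADOW of the conclusion (`ξ(t)/t` converges);
* `inertialRecession_false_without_fieldEquations_cesaro : ¬ …` — the SAME witness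
  `centre c t = c ∫₀ᵗ cos (log (1 + s²) / 2) ds` as in `KinematicShadow.lean`: its Cesàro mean is
  `(cos (log t) + sin (log t)) / 2 + O(1/t)`, equal to `1/2 + o(1)` and to `-1/2 + o(1)` at arbitrarily
  late times (`not_tendsto_centre_div`);
* `tendsto_div_of_tendsto_deriv` (frozen velocity ⇒ Cesàro velocity) and
  `withoutFieldEquationsCesaro_of` : the Cesàro shadow statement is implied by the frozen one, so this
  refutation STRENGTHENS `inertialRecession_false_without_fieldEquations`.

Hence the transfer target "Cesàro velocities" of the crux chain is genuinely dynamical: it must come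
from conservation laws of the development (rate-free balance at clean scales), not from `C³` decay of the
modulated ansatz. Standing disprover's work file: `Cruxes/InertialRecession/Disproof.lean` §G.
-/

set_option linter.dupNamespace false

noncomputable section

namespace Summit.FinalStateConjecture.FinalStateConjecture.Theorems.InertialRecession.Negative

open Filter Set
open scoped Topology

/-- FROZEN ⇒ CESÀRO: if `ξ' → v` then `ξ(t)/t → v`. [folklore] -/
theorem tendsto_div_of_tendsto_deriv {ξ ξ' : ℝ → ℝ} {v : ℝ} (hξ : ∀ t, HasDerivAt ξ (ξ' t) t)
    (h : Tendsto ξ' atTop (𝓝 v)) : Tendsto (fun t ↦ ξ t / t) atTop (𝓝 v) := by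
  rw [Metric.tendsto_atTop]
  intro ε hε
  have hε2 : 0 < ε / 2 := by positivity
  obtain ⟨T, hT⟩ := (Metric.tendsto_atTop.mp h) (ε / 2) hε2
  -- after `T` the velocity is within `ε/2` of `v`
  set T' := max T 1 with hT'
  have hT'1 : 1 ≤ T' := le_max_right _ _
  have hT'T : T ≤ T' := le_max_left _ _
  -- the constant `C := |ξ T' - v T'|`
  set C := |ξ T' - v * T'| with hC
  obtain ⟨N, hN⟩ := exists_nat_gt (max T' (2 * C / ε))
  refine ⟨N, fun t ht ↦ ?_⟩
  have htT' : T' ≤ t := le_trans (le_max_left _ _) (le_of_lt (lt_of_lt_of_le hN ht))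
  have ht0 : 0 < t := by linarith
  have htC : 2 * C / ε < t := lt_of_le_of_lt (le_max_right _ _) (lt_of_lt_of_le hN ht)
  -- mean value bound for `f s = ξ s - v s` on `[T', t]`
  have hf : ∀ s ∈ Icc T' t, HasDerivWithinAt (fun s ↦ ξ s - v * s) (ξ' s - v) (Icc T' t) s :=
    fun s _ ↦ ((hξ s).sub ((hasDerivAt_id s).const_mul v)).hasDerivWithinAt.congr_deriv (by ring)
  have hbound : ∀ s ∈ Ico T' t, ‖ξ' s - v‖ ≤ ε / 2 := fun s hs ↦ by
    have := hT s (le_trans hT'T hs.1)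
    rw [Real.dist_eq] at this
    exact (Real.norm_eq_abs _).le.trans this.le
  have hmv := norm_image_sub_le_of_norm_deriv_le_segment' hf hbound t (right_mem_Icc.mpr htT')
  rw [Real.norm_eq_abs] at hmv
  rw [Real.dist_eq]
  have key : ξ t / t - v = ((ξ t - v * t) - (ξ T' - v * T')) / t + (ξ T' - v * T') / t := by
    field_simp
    ring
  rw [key]
  calc |((ξ t - v * t) - (ξ T' - v * T')) / t + (ξ T' - v * T') / t|
      ≤ |((ξ t - v * t) - (ξ T' - v * T')) / t| + |(ξ T' - v * T') / t| := abs_add_le _ _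
    _ = |(ξ t - v * t) - (ξ T' - v * T')| / t + C / t := by
        rw [abs_div, abs_div, abs_of_pos ht0]
    _ ≤ (ε / 2 * (t - T')) / t + C / t := by
        gcongr
    _ < ε / 2 + ε / 2 := by
        apply add_lt_add_of_le_of_lt
        · rw [div_le_iff₀ ht0]
          nlinarith
        · rw [div_lt_iff₀ ht0]
          rw [div_lt_iff₀ hε] at htC
          linarith
    _ = ε := by ring


/-! ## The Cesàro mean of the witness oscillates -/

/-- The exact antiderivative of `cos ∘ log` on `(0, ∞)`: `t (cos (log t) + sin (log t)) / 2`. [folklore] -/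
def cesaroModel (t : ℝ) : ℝ := t * (Real.cos (Real.log t) + Real.sin (Real.log t)) / 2

/-- `cesaroModel' = cos ∘ log` on `(0, ∞)`. [folklore] -/
lemma hasDerivAt_cesaroModel {t : ℝ} (ht : 0 < t) :
    HasDerivAt cesaroModel (Real.cos (Real.log t)) t := by
  have hl : HasDerivAt Real.log t⁻¹ t := Real.hasDerivAt_log ht.ne'
  have h1 : HasDerivAt (fun t ↦ Real.cos (Real.log t) + Real.sin (Real.log t))
      (-Real.sin (Real.log t) * t⁻¹ + Real.cos (Real.log t) * t⁻¹) t := hl.cos.add hl.sin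
  have h2 := ((hasDerivAt_id t).mul h1).div_const 2
  refine h2.congr_deriv ?_
  simp only [id]
  field_simp
  ring

/-- `|cos (log (1 + t²) / 2) - cos (log t)| ≤ t⁻² / 2` for `t ≥ 1`. [folklore] -/
lemma abs_vel_sub_cos_log_le {t : ℝ} (ht : 1 ≤ t) :
    |vel t - Real.cos (Real.log t)| ≤ t⁻¹ ^ 2 / 2 := by
  have ht0 : 0 < t := by linarith
  unfold vel phase
  refine (Real.abs_cos_sub_cos_le _ _).trans ?_
  have hlog : Real.log (1 + t ^ 2) / 2 - Real.log t = Real.log (1 + t⁻¹ ^ 2) / 2 := by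
    have h1 : (1 + t ^ 2) = t ^ 2 * (1 + t⁻¹ ^ 2) := by field_simp; ring
    rw [h1, Real.log_mul (by positivity) (by positivity), Real.log_pow]
    push_cast
    ring
  rw [hlog]
  have hpos : 0 < 1 + t⁻¹ ^ 2 := by positivity
  have hle : Real.log (1 + t⁻¹ ^ 2) ≤ t⁻¹ ^ 2 := by
    have := Real.log_le_sub_one_of_pos hpos
    linarith
  have hge : 0 ≤ Real.log (1 + t⁻¹ ^ 2) := Real.log_nonneg (by nlinarith [sq_nonneg t⁻¹])
  rw [abs_of_nonneg (by linarith)]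
  linarith

/-- The remainder `H t = ∫₀ᵗ vel - cesaroModel t` stays within `1/2` of `H 1` on `[1, ∞)`. [folklore] -/
lemma abs_centre_one_sub_cesaroModel_sub_le {t : ℝ} (ht : 1 ≤ t) :
    |(centre 1 t - cesaroModel t) - (centre 1 1 - cesaroModel 1)| ≤ 1 / 2 := by
  -- `K s = H s + s⁻¹/2` is antitone and `L s = H s - s⁻¹/2` is monotone on `[1, ∞)`
  have hH : ∀ s, 0 < s → HasDerivAt (fun s ↦ centre 1 s - cesaroModel s)
      (vel s - Real.cos (Real.log s)) s := fun s hs ↦ by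
    exact ((hasDerivAt_centre 1 s).sub (hasDerivAt_cesaroModel hs)).congr_deriv (by rw [one_mul])
  have hinv : ∀ s, 0 < s → HasDerivAt (fun s : ℝ ↦ s⁻¹ / 2) (-(s ^ 2)⁻¹ / 2) s := fun s hs ↦ by
    simpa using (hasDerivAt_inv hs.ne').div_const 2
  have hcont : ∀ {f f' : ℝ → ℝ}, (∀ s, 0 < s → HasDerivAt f (f' s) s) → ContinuousOn f (Ici 1) :=
    fun h ↦ fun s hs ↦ (h s (by simpa using lt_of_lt_of_le one_pos hs)).continuousAt.continuousWithinAt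
  have hK : AntitoneOn (fun s ↦ (centre 1 s - cesaroModel s) + s⁻¹ / 2) (Ici 1) := by
    refine antitoneOn_of_hasDerivWithinAt_nonpos (convex_Ici 1) (hcont fun s hs ↦ (hH s hs).add
      (hinv s hs)) (fun s hs ↦ ((hH s ?_).add (hinv s ?_)).hasDerivWithinAt) fun s hs ↦ ?_
    · simpa using lt_trans one_pos (by simpa using hs)
    · simpa using lt_trans one_pos (by simpa using hs)
    · rw [interior_Ici] at hs
      have hs1 : 1 ≤ s := le_of_lt hs
      have := abs_vel_sub_cos_log_le hs1
      have h' : (s ^ 2)⁻¹ = s⁻¹ ^ 2 := by rw [inv_pow]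
      rw [h']
      linarith [le_abs_self (vel s - Real.cos (Real.log s))]
  have hL : MonotoneOn (fun s ↦ (centre 1 s - cesaroModel s) - s⁻¹ / 2) (Ici 1) := by
    refine monotoneOn_of_hasDerivWithinAt_nonneg (convex_Ici 1) (hcont fun s hs ↦ (hH s hs).sub
      (hinv s hs)) (fun s hs ↦ ((hH s ?_).sub (hinv s ?_)).hasDerivWithinAt) fun s hs ↦ ?_
    · simpa using lt_trans one_pos (by simpa using hs)
    · simpa using lt_trans one_pos (by simpa using hs)
    · rw [interior_Ici] at hs
      have hs1 : 1 ≤ s := le_of_lt hs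
      have := abs_vel_sub_cos_log_le hs1
      have h' : (s ^ 2)⁻¹ = s⁻¹ ^ 2 := by rw [inv_pow]
      rw [h']
      linarith [neg_abs_le (vel s - Real.cos (Real.log s))]
  have h1 := hK (self_mem_Ici) (ht) ht
  have h2 := hL (self_mem_Ici) (ht) ht
  simp only [inv_one] at h1 h2
  have hti : 0 ≤ t⁻¹ := inv_nonneg.mpr (by linarith)
  have hti' : t⁻¹ ≤ 1 := inv_le_one_of_one_le₀ ht
  rw [abs_le]
  constructor <;> linarith

/-- The Cesàro mean of the witness: `(∫₀ᵗ vel) / t - (cos (log t) + sin (log t)) / 2 → 0`. [folklore] -/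
theorem tendsto_centre_one_div_sub :
    Tendsto (fun t ↦ centre 1 t / t - (Real.cos (Real.log t) + Real.sin (Real.log t)) / 2)
      atTop (𝓝 0) := by
  set C := |centre 1 1 - cesaroModel 1| + 1 / 2 with hC
  refine squeeze_zero_norm' ?_ ((tendsto_inv_atTop_zero.const_mul C).trans_eq (by simp))
  filter_upwards [eventually_ge_atTop 1] with t ht
  have ht0 : 0 < t := by linarith
  have key : centre 1 t / t - (Real.cos (Real.log t) + Real.sin (Real.log t)) / 2 =
      (centre 1 t - cesaroModel t) / t := by
    unfold cesaroModel
    field_simp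
  rw [key, Real.norm_eq_abs, abs_div, abs_of_pos ht0, div_eq_mul_inv]
  refine mul_le_mul_of_nonneg_right ?_ (inv_nonneg.mpr ht0.le)
  have := abs_centre_one_sub_cesaroModel_sub_le ht
  have htri := abs_sub_abs_le_abs_sub (centre 1 t - cesaroModel t) (centre 1 1 - cesaroModel 1)
  linarith

/-- `cos (log t) + sin (log t) = 1` at `t = exp (2πn)`, arbitrarily late. [folklore] -/
lemma frequently_cos_log_add_sin_log_eq_one :
    ∃ᶠ t in atTop, Real.cos (Real.log t) + Real.sin (Real.log t) = 1 := by
  rw [frequently_atTop]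
  intro a
  obtain ⟨n, hn⟩ := exists_nat_ge a
  refine ⟨Real.exp (n * (2 * Real.pi)), ?_, ?_⟩
  · refine hn.trans ((le_trans ?_ (Real.add_one_le_exp _)))
    nlinarith [Real.pi_gt_three, (Nat.cast_nonneg n : (0 : ℝ) ≤ n), sq_nonneg (n : ℝ)]
  · rw [Real.log_exp, Real.cos_nat_mul_two_pi, Real.sin_periodic.nat_mul_eq, Real.sin_zero]
    ring

/-- `cos (log t) + sin (log t) = -1` at `t = exp (2πn + π)`, arbitrarily late. [folklore] -/
lemma frequently_cos_log_add_sin_log_eq_neg_one :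
    ∃ᶠ t in atTop, Real.cos (Real.log t) + Real.sin (Real.log t) = -1 := by
  rw [frequently_atTop]
  intro a
  obtain ⟨n, hn⟩ := exists_nat_ge a
  refine ⟨Real.exp (n * (2 * Real.pi) + Real.pi), ?_, ?_⟩
  · refine hn.trans ((le_trans ?_ (Real.add_one_le_exp _)))
    nlinarith [Real.pi_gt_three, (Nat.cast_nonneg n : (0 : ℝ) ≤ n), sq_nonneg (n : ℝ)]
  · rw [Real.log_exp, Real.cos_nat_mul_two_pi_add_pi, Real.sin_add_pi,
      Real.sin_periodic.nat_mul_eq, Real.sin_zero]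
    ring

/-- **The witness has no Cesàro velocity**: `centre c t / t` does not converge (`c ≠ 0`). [folklore] -/
theorem not_tendsto_centre_div {c : ℝ} (hc : c ≠ 0) :
    ¬ ∃ V : ℝ, Tendsto (fun t ↦ centre c t / t) atTop (𝓝 V) := by
  rintro ⟨V, hV⟩
  have hc1 : ∀ t, centre c t = c * centre 1 t := fun t ↦ by simp [centre]
  have h1 : Tendsto (fun t ↦ centre 1 t / t) atTop (𝓝 (V / c)) := by
    have := hV.div_const c
    refine this.congr' (Eventually.of_forall fun t ↦ ?_)
    rw [hc1]
    field_simp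
  -- `Q t := centre 1 t / t - (centre 1 t / t - trig) = trig → V/c`, but `Q` is frequently `± 1/2`
  have hQ : Tendsto (fun t ↦ centre 1 t / t -
      (centre 1 t / t - (Real.cos (Real.log t) + Real.sin (Real.log t)) / 2)) atTop
      (𝓝 (V / c - 0)) := h1.sub tendsto_centre_one_div_sub
  have hQ' : Tendsto (fun t ↦ (Real.cos (Real.log t) + Real.sin (Real.log t)) / 2) atTop
      (𝓝 (V / c)) := by
    rw [sub_zero] at hQ
    exact hQ.congr' (Eventually.of_forall fun t ↦ by ring)
  have e1 : V / c = 1 / 2 := tendsto_nhds_unique_of_frequently_eq hQ' tendsto_const_nhds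
    (frequently_cos_log_add_sin_log_eq_one.mono fun t ht ↦ by rw [ht])
  have e2 : V / c = -1 / 2 := tendsto_nhds_unique_of_frequently_eq hQ' tendsto_const_nhds
    (frequently_cos_log_add_sin_log_eq_neg_one.mono fun t ht ↦ by rw [ht])
  linarith

/-! ## The Cesàro shadow of the crux and its refutation -/

/-- `InertialRecession` with the field equations DROPPED, kinematics kept, and the conclusion weakened
to its CESÀRO SHADOW: antecedent = the kinematic shadow of the crux for one centre along one axis
(`C^∞`, eventually inside the cone `κ² t`, `0 < κ < 1`, speed `≤ κ²`, second and third derivatives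
`→ 0`); conclusion = `ξ(t)/t` converges — the one asymptotic datum per hole that the typed
`FinalStateDecomposition` (sublinear tubes around straight world-lines) really needs. Refuted below.
[topic: Summits/FinalStateConjecture/FinalStateConjecture — multi-black-hole kinematics, crux InertialRecession] -/
def InertialRecessionWithoutFieldEquationsCesaro : Prop :=
  ∀ (κ : ℝ) (ξ : ℝ → ℝ), ContDiff ℝ ((⊤ : ℕ∞) : WithTop ℕ∞) ξ → 0 < κ → κ < 1 →
    (∀ᶠ t in atTop, |ξ t| ≤ κ ^ 2 * t) → (∀ t, |deriv ξ t| ≤ κ ^ 2) →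
      Tendsto (deriv^[2] ξ) atTop (𝓝 0) → Tendsto (deriv^[3] ξ) atTop (𝓝 0) →
        ∃ V : ℝ, Tendsto (fun t ↦ ξ t / t) atTop (𝓝 V)

/-- The Cesàro shadow statement is WEAKER than the frozen one of `KinematicShadow.lean`
(frozen ⇒ Cesàro), so refuting it is the stronger negative result. [folklore] -/
theorem withoutFieldEquationsCesaro_of (h : InertialRecessionWithoutFieldEquations) :
    InertialRecessionWithoutFieldEquationsCesaro := fun κ ξ hξ hκ hκ1 hcone hspeed h2 h3 ↦ by
  obtain ⟨v, hv⟩ := h κ ξ hξ hκ hκ1 hcone hspeed h2 h3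
  have hd : Differentiable ℝ ξ := hξ.differentiable (by simp)
  exact ⟨v, tendsto_div_of_tendsto_deriv (fun t ↦ (hd t).hasDerivAt) hv⟩

/-- **The kinematic shadow does not even give Cesàro velocities** (witness `centre (1/4)`: Cesàro
mean `(cos (log t) + sin (log t))/8 + o(1)`, frequently `1/8 + o(1)` and `-1/8 + o(1)`). Any proof of
the crux must extract the Cesàro velocity from the field equations (conservation laws of the
development), not from `C³` decay of the modulated ansatz. [folklore] -/
theorem inertialRecession_false_without_fieldEquations_cesaro :
    ¬ InertialRecessionWithoutFieldEquationsCesaro := fun h ↦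
  not_tendsto_centre_div (by norm_num : (1 / 4 : ℝ) ≠ 0)
    (h (1 / 2) _ (contDiff_centre _) (by norm_num) (by norm_num) eventually_abs_centre_le
      abs_deriv_centre_le (tendsto_deriv2_centre _) (tendsto_deriv3_centre _))

/-- Sanity: the new refutation recovers `inertialRecession_false_without_fieldEquations`. -/
example : ¬ InertialRecessionWithoutFieldEquations :=
  fun h ↦ inertialRecession_false_without_fieldEquations_cesaro (withoutFieldEquationsCesaro_of h)

end Summit.FinalStateConjecture.FinalStateConjecture.Theorems.InertialRecession.Negative

end
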